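import Summits.QuantumFields.BalabanUV.Beta.D1BFx.ChartDefectCorrectorWords
import Summits.QuantumFields.BalabanUV.Beta.D1BFx.ChartDefectCorrectorChannel
import Summits.QuantumFields.BalabanUV.Beta.BorderedHessianSymmetry

/-!
# `BalabanUV.Beta.D1BFx.ChartDefectCorrectorChannelRecord` — road «BF-x», binder row D1, PART 24-hyb HEAD RE-PAIRED, the OWNER's leg (c2), PART 5:
# **Φ-CHANNEL ISOLATION AT THE ROAD's PIN** — PART 4's abstract identity instantiated with the slice-internal corrector `Ẽ := (psiKS (ctrOff) n − idK)∘axEc ρ_c n`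
# of PART 1: EVERY spread kernel `Φ` WITHOUT FIELD LEGS (no field rows, no field columns — e.g. the multiplier–multiplier block of the road's kernel,
# leaf-01 g35's `Φ`) is corrector-blind (`Ẽ∘Φ = 0 = Φ∘Ẽᵀ`, because `Ẽ` is field–field), hence for ANY localised `V`, `W`
# `hessKer (GcombSh n 0) V W μνz − hessKer G₀ V W μνz = (hessKer ((idK+Ẽ)∘(G₀−Φ)∘(idK+Ẽ)ᵀ) V W μνz − hessKer (G₀−Φ) V W μνz)`
# `   − ½·(tr (Φ∘V μ0∘(GcombSh n 0 − G₀)∘V νz) + tr (Φ∘V νz∘(GcombSh n 0 − G₀)∘V μ0))`.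
Located, zero weight: the multiplier–multiplier block of the road's kernel enters the (lead)-type difference ONLY through the displayed bilinear word
(two multiplier legs of the vertices against the kernel difference `GcombSh n 0 − G₀ = −G₀∘Dsh∘G′`); NO word is priced, NO n-law asserted; which `Φ` to
split off is the counting seat's choice (the hypotheses are support conditions only); §3 supplies the canonical one in the tree's vocabulary —
the multiplier–multiplier block `½•(G₀ + sgnK G₀) − ffK G₀` (`BorderedHessianSymmetry.sgnK`, `WardLocusStencils.ffK`) — and `lead_eq_blind_add_mmChannel`.

HONEST DEPENDENCY (cell records, verbatim): «continuum YM on T⁴ ⇐ BetaPertH ∧ nine spine estimates (0/9 proved); BetaPertH ⇐ (D1) ∧ (D4) ∧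
CAP+tail; G-an2-4 gates asym, D1 and NE2/3/4.»  HONEST FRAMING (cell contract, verbatim): «discharging `BetaPertH` makes Bałaban's UV stability
UNCONDITIONAL — a real constructive-QFT result; it is NOT the continuum limit and NOT the Clay problem.»  THIS MODULE DISCHARGES NOTHING of the wall:
[folklore] finite-sum support bookkeeping + PART 1 ∕ PART 4 BY NAME; no definition, no `def … : Prop`, nothing cited, 0 sorry, default heartbeats.
0∕4 row-D1 binders; (K) NOT closed; (J1) ONE OPEN ROW; NOT D1, NEVER «G-an2-4 closed», NOT `BetaPertH`, NOT continuum, NOT Clay.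

ABSOLUTE RULE (cell charter, verbatim): «No internally-minted statement may enter as a cited fact. Every hypothesis is either kernel-proved in this
package or a verbatim quotation of a PUBLISHED theorem with page reference. The manuscript(s) under audit are NOT citable for their own disputed
steps — they are the thing under adjudication; programme-internal (2001/route/tribunal) claims are never citable.»

Unit `b2b-balaban-beta-d1-p2` (road owner, gen 27), 2026-08-24; no existing file touched.
-/

noncomputable section

namespace Summit.QuantumFields.BalabanUV.Beta.D1BFx.ChartDefectCorrectorChannelRecord

open Finset
open scoped BigOperators
open Literature.Probability.LatticeModels (Torus.proj)
open Literature.MathematicalPhysics.QuantumFieldTheory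
open Literature.MathematicalPhysics.QuantumFieldTheory.Balaban1983to89
open Literature.MathematicalPhysics.QuantumFieldTheory.Balaban1983to89.Beta
open ExpKernelCalculus (MKer comp tr hessKer)
open HessKerSchurResolvent (idK)
open OneStepResolventKernel (Fib)
open OneStepKernelFamily (KInvStep)
open AffineAveraging (Site box)
open AveragingContoursRooted (ctr ctrOff ctrOff_mem_box)
open Summit.QuantumFields.BalabanUV.Beta.TameKernelCalculus
open Summit.QuantumFields.BalabanUV.Beta.ChartConjugationRelative (spr_comp)
open Summit.QuantumFields.BalabanUV.Beta.AxialDressingRooted (axEc spr_axEc comp_axEc_apply' coDressKBmAt)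
open Summit.QuantumFields.BalabanUV.Beta.BorderedHessian (sgnK sgnK_apply sgnF_inl sgnF_inr)
open Summit.QuantumFields.BalabanUV.Beta.WardLocusStencils (ffK ffK_inl_inl ffK_inl_inr ffK_inr_inl ffK_inr_inr)
open Summit.QuantumFields.BalabanUV.Beta.D1BFx.FineHessianLegGrades (spr_sub' spr_add')
open Summit.QuantumFields.BalabanUV.Beta.RelInvNullShift (spr_smul)
open Summit.QuantumFields.BalabanUV.Beta.CombChartStepJets (GcombSh)
open Summit.QuantumFields.BalabanUV.Beta.SymCorrectorKernel (psiKS)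
open Summit.QuantumFields.BalabanUV.Beta.D1BFx.ChartDefectResolvent (spr_G0bm_ctr)
open Summit.QuantumFields.BalabanUV.Beta.D1BFx.ChartDefectCorrectorWords (E_inr E_inr_right spr_E GcombSh_zero_eq_conj_Etilde)
open Summit.QuantumFields.BalabanUV.Beta.D1BFx.ChartDefectCorrectorChannel (conjDefect_eq_blind_add_channel)

variable {d : ℕ}

/-! ## §1 The slice-internal corrector has no multiplier legs; kernels without field legs are corrector-blind -/

section Blind

variable (ρ : Fin (d + 1) → ℤ) (r : Fin (d + 1) → ℕ) (N : ℕ)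

open Classical in
/-- [folklore] `Ẽ := E∘axEc ρ N` has no multiplier columns. -/
theorem Etilde_inr_right (x z : Site (d + 1)) (a : Fib d) (μ : Fin (d + 1)) :
    comp (psiKS r N - idK) (axEc ρ N) x z a (Sum.inr μ) = 0 := by
  rw [comp_axEc_apply']
  show (if Torus.proj N z = 0 then (psiKS r N - idK : MKer (d + 1) (Fib d)) x z a (Sum.inr μ) else 0) = 0
  rw [E_inr_right]; split_ifs <;> rfl

open Classical in
/-- [folklore] `Ẽ` has no multiplier rows. -/
theorem Etilde_inr_left (x z : Site (d + 1)) (μ : Fin (d + 1)) (b : Fib d) :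
    comp (psiKS r N - idK) (axEc ρ N) x z (Sum.inr μ) b = 0 := by
  rw [comp_axEc_apply']
  rcases b with β | m
  · show (if _ then 0 else (psiKS r N - idK : MKer (d + 1) (Fib d)) x z (Sum.inr μ) (Sum.inl β)) = 0
    rw [E_inr]; split_ifs <;> rfl
  · show (if Torus.proj N z = 0 then (psiKS r N - idK : MKer (d + 1) (Fib d)) x z (Sum.inr μ) (Sum.inr m) else 0) = 0
    rw [E_inr]; split_ifs <;> rfl

/-- [folklore] **A KERNEL WITHOUT FIELD ROWS IS INVISIBLE TO `Ẽ` ON THE LEFT**: `Ẽ∘Φ = 0` (every summand has a vanishing factor). -/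
theorem comp_Etilde_eq_zero_of_noFieldRows {Φ : MKer (d + 1) (Fib d)} (hΦ : ∀ x y (α : Fin (d + 1)) b, Φ x y (Sum.inl α) b = 0) :
    comp (comp (psiKS r N - idK) (axEc ρ N)) Φ = 0 := by
  funext x z a b
  show (∑' y, ∑ f : Fib d, comp (psiKS r N - idK) (axEc ρ N) x y a f * Φ y z f b) = 0
  have e : ∀ y, ∑ f : Fib d, comp (psiKS r N - idK) (axEc ρ N) x y a f * Φ y z f b = 0 := fun y =>
    Finset.sum_eq_zero fun f _ => by
      rcases f with α | μ
      · rw [hΦ, mul_zero]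
      · rw [Etilde_inr_right, zero_mul]
  simp_rw [e]; exact tsum_zero

/-- [folklore] **A KERNEL WITHOUT FIELD COLUMNS IS INVISIBLE TO `Ẽᵀ` ON THE RIGHT**: `Φ∘Ẽᵀ = 0`. -/
theorem comp_trK_Etilde_eq_zero_of_noFieldCols {Φ : MKer (d + 1) (Fib d)} (hΦ : ∀ x y a (β : Fin (d + 1)), Φ x y a (Sum.inl β) = 0) :
    comp Φ (trK (comp (psiKS r N - idK) (axEc ρ N))) = 0 := by
  funext x z a b
  show (∑' y, ∑ f : Fib d, Φ x y a f * trK (comp (psiKS r N - idK) (axEc ρ N)) y z f b) = 0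
  have e : ∀ y, ∑ f : Fib d, Φ x y a f * trK (comp (psiKS r N - idK) (axEc ρ N)) y z f b = 0 := fun y =>
    Finset.sum_eq_zero fun f _ => by
      rcases f with β | μ
      · rw [hΦ, zero_mul]
      · rw [trK_apply, Etilde_inr_right, mul_zero]
  simp_rw [e]; exact tsum_zero

end Blind

/-! ## §2 Φ-channel isolation at the road's pin -/

section Record

variable (n : ℕ) [NeZero n]

/-- [folklore] **Φ-CHANNEL ISOLATION AT THE RECORD.**  `G₀ := coDressKBmAt ρ_c n (KInvStep n 0)`, `Ẽ := (psiKS (ctrOff (d+1) n) n − idK)∘axEc ρ_c n`, `P := idK + Ẽ`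
(so `P∘G₀∘Pᵀ = GcombSh n 0`, PART 1).  For every spread `Φ` WITHOUT FIELD LEGS and all localised `V`, `W`:
`hessKer (GcombSh n 0) V W μνz − hessKer G₀ V W μνz = (hessKer (P∘(G₀−Φ)∘Pᵀ) V W μνz − hessKer (G₀−Φ) V W μνz)`
`  − ½·(tr (Φ∘V μ0∘(GcombSh n 0 − G₀)∘V νz) + tr (Φ∘V νz∘(GcombSh n 0 − G₀)∘V μ0))` (PART 4 `conjDefect_eq_blind_add_channel` + §1). -/
theorem lead_eq_blind_add_channel {Φ : MKer (d + 1) (Fib d)} (hΦs : Spr Φ)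
    (hΦr : ∀ x y (α : Fin (d + 1)) b, Φ x y (Sum.inl α) b = 0) (hΦc : ∀ x y a (β : Fin (d + 1)), Φ x y a (Sum.inl β) = 0)
    {V : Fin (d + 1) → (Fin (d + 1) → ℤ) → MKer (d + 1) (Fib d)} {W : Fin (d + 1) → (Fin (d + 1) → ℤ) → Fin (d + 1) → (Fin (d + 1) → ℤ) → MKer (d + 1) (Fib d)}
    (hV : ∀ μ y, Loc (V μ y)) (hW : ∀ μ y ν y', Loc (W μ y ν y')) (μ ν : Fin (d + 1)) (z : Fin (d + 1) → ℤ) :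
    hessKer (GcombSh (d := d) n 0) V W μ ν z - hessKer (coDressKBmAt (ctr (d + 1) n) n (KInvStep (d := d) n 0)) V W μ ν z
      = (hessKer (comp (comp (idK + comp (psiKS (ctrOff (d + 1) n) n - idK) (axEc (ctr (d + 1) n) n))
            (coDressKBmAt (ctr (d + 1) n) n (KInvStep (d := d) n 0) - Φ)) (trK (idK + comp (psiKS (ctrOff (d + 1) n) n - idK) (axEc (ctr (d + 1) n) n)))) V W μ ν z
          - hessKer (coDressKBmAt (ctr (d + 1) n) n (KInvStep (d := d) n 0) - Φ) V W μ ν z)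
        - (1 / 2) * (tr (comp (comp (comp Φ (V μ 0)) (GcombSh (d := d) n 0 - coDressKBmAt (ctr (d + 1) n) n (KInvStep (d := d) n 0))) (V ν z))
                    + tr (comp (comp (comp Φ (V ν z)) (GcombSh (d := d) n 0 - coDressKBmAt (ctr (d + 1) n) n (KInvStep (d := d) n 0))) (V μ 0))) := by
  have hn : 0 < n := Nat.pos_of_ne_zero (NeZero.ne n)
  have hT : Spr (comp (psiKS (ctrOff (d + 1) n) n - idK) (axEc (ctr (d + 1) n) n)) := spr_comp (spr_E hn (ctrOff_mem_box hn)) (spr_axEc _ n)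
  rw [GcombSh_zero_eq_conj_Etilde n]
  exact conjDefect_eq_blind_add_channel spr_G0bm_ctr hΦs hT (comp_Etilde_eq_zero_of_noFieldRows _ _ n hΦr)
    (comp_trK_Etilde_eq_zero_of_noFieldCols _ _ n hΦc) hV hW μ ν z

end Record

/-! ## §3 The multiplier–multiplier block in the tree's vocabulary: `½•(K + sgnK K) − ffK K` -/

section MMBlock

variable (K : MKer (d + 1) (Fib d)) (x y : Site (d + 1))

/-- [folklore] `½•(K + sgnK K) − ffK K` has no field rows (`sgnK` flips the mixed blocks, `ffK` is the field–field block). -/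
theorem mmBlock_inl (α : Fin (d + 1)) (b : Fib d) : ((1 / 2 : ℝ) • (K + sgnK K) - ffK K) x y (Sum.inl α) b = 0 := by
  show (1 / 2 : ℝ) * (K x y (Sum.inl α) b + sgnK K x y (Sum.inl α) b) - ffK K x y (Sum.inl α) b = 0
  rcases b with β | m
  · rw [sgnK_apply, sgnF_inl, sgnF_inl, ffK_inl_inl]; ring
  · rw [sgnK_apply, sgnF_inl, sgnF_inr, ffK_inl_inr]; ring

/-- [folklore] `½•(K + sgnK K) − ffK K` has no field columns. -/
theorem mmBlock_inl_right (a : Fib d) (β : Fin (d + 1)) : ((1 / 2 : ℝ) • (K + sgnK K) - ffK K) x y a (Sum.inl β) = 0 := by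
  show (1 / 2 : ℝ) * (K x y a (Sum.inl β) + sgnK K x y a (Sum.inl β)) - ffK K x y a (Sum.inl β) = 0
  rcases a with α | m
  · rw [sgnK_apply, sgnF_inl, sgnF_inl, ffK_inl_inl]; ring
  · rw [sgnK_apply, sgnF_inr, sgnF_inl, ffK_inr_inl]; ring

/-- [folklore] **`½•(K + sgnK K) − ffK K` IS THE MULTIPLIER–MULTIPLIER BLOCK OF `K`.** -/
theorem mmBlock_inr_inr (m m' : Fin (d + 1)) : ((1 / 2 : ℝ) • (K + sgnK K) - ffK K) x y (Sum.inr m) (Sum.inr m') = K x y (Sum.inr m) (Sum.inr m') := by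
  show (1 / 2 : ℝ) * (K x y (Sum.inr m) (Sum.inr m') + sgnK K x y (Sum.inr m) (Sum.inr m')) - ffK K x y (Sum.inr m) (Sum.inr m') = _
  rw [sgnK_apply, sgnF_inr, sgnF_inr, ffK_inr_inr]; ring

omit x y in
/-- [folklore] The field–field block of a spread kernel is spread (entries dominated by those of `K`). -/
theorem spr_ffK (hK : Spr K) : Spr (ffK K) := by
  obtain ⟨C, δ, hδ, h⟩ := hK
  refine ⟨|C|, δ, hδ, fun x y a b => ?_⟩
  have hC : |K x y a b| ≤ |C| * Real.exp (-δ * B12Sec2to5.l1 (x - y)) :=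
    (h x y a b).trans (mul_le_mul_of_nonneg_right (le_abs_self C) (Real.exp_pos _).le)
  have h0 : (0 : ℝ) ≤ |C| * Real.exp (-δ * B12Sec2to5.l1 (x - y)) := by positivity
  rcases a with α | m <;> rcases b with β | m'
  · rw [ffK_inl_inl]; exact hC
  · rw [ffK_inl_inr, abs_zero]; exact h0
  · rw [ffK_inr_inl, abs_zero]; exact h0
  · rw [ffK_inr_inr, abs_zero]; exact h0

omit x y in
/-- [folklore] The multiplier–multiplier block of a spread kernel is spread. -/
theorem spr_mmBlock (hK : Spr K) : Spr ((1 / 2 : ℝ) • (K + sgnK K) - ffK K) :=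
  spr_sub' (spr_smul _ (spr_add' hK (BorderedHessian.spr_sgnK hK))) (spr_ffK K hK)

end MMBlock

section RecordMM

variable (n : ℕ) [NeZero n]

/-- [folklore] **THE MULTIPLIER–MULTIPLIER BLOCK OF THE ROAD's KERNEL MEETS (lead) THROUGH ONE WORD**: `lead_eq_blind_add_channel` at
`Φ := ½•(G₀ + sgnK G₀) − ffK G₀` (the mm-block of `G₀`, §3) — for all localised `V`, `W`. -/
theorem lead_eq_blind_add_mmChannel
    {V : Fin (d + 1) → (Fin (d + 1) → ℤ) → MKer (d + 1) (Fib d)} {W : Fin (d + 1) → (Fin (d + 1) → ℤ) → Fin (d + 1) → (Fin (d + 1) → ℤ) → MKer (d + 1) (Fib d)}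
    (hV : ∀ μ y, Loc (V μ y)) (hW : ∀ μ y ν y', Loc (W μ y ν y')) (μ ν : Fin (d + 1)) (z : Fin (d + 1) → ℤ) :
    hessKer (GcombSh (d := d) n 0) V W μ ν z - hessKer (coDressKBmAt (ctr (d + 1) n) n (KInvStep (d := d) n 0)) V W μ ν z
      = (hessKer (comp (comp (idK + comp (psiKS (ctrOff (d + 1) n) n - idK) (axEc (ctr (d + 1) n) n))
            (coDressKBmAt (ctr (d + 1) n) n (KInvStep (d := d) n 0)
              - ((1 / 2 : ℝ) • (coDressKBmAt (ctr (d + 1) n) n (KInvStep (d := d) n 0) + sgnK (coDressKBmAt (ctr (d + 1) n) n (KInvStep (d := d) n 0)))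
                  - ffK (coDressKBmAt (ctr (d + 1) n) n (KInvStep (d := d) n 0)))))
            (trK (idK + comp (psiKS (ctrOff (d + 1) n) n - idK) (axEc (ctr (d + 1) n) n)))) V W μ ν z
          - hessKer (coDressKBmAt (ctr (d + 1) n) n (KInvStep (d := d) n 0)
              - ((1 / 2 : ℝ) • (coDressKBmAt (ctr (d + 1) n) n (KInvStep (d := d) n 0) + sgnK (coDressKBmAt (ctr (d + 1) n) n (KInvStep (d := d) n 0)))
                  - ffK (coDressKBmAt (ctr (d + 1) n) n (KInvStep (d := d) n 0)))) V W μ ν z)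
        - (1 / 2) * (tr (comp (comp (comp ((1 / 2 : ℝ) • (coDressKBmAt (ctr (d + 1) n) n (KInvStep (d := d) n 0) + sgnK (coDressKBmAt (ctr (d + 1) n) n (KInvStep (d := d) n 0)))
                                          - ffK (coDressKBmAt (ctr (d + 1) n) n (KInvStep (d := d) n 0))) (V μ 0))
                              (GcombSh (d := d) n 0 - coDressKBmAt (ctr (d + 1) n) n (KInvStep (d := d) n 0))) (V ν z))
                    + tr (comp (comp (comp ((1 / 2 : ℝ) • (coDressKBmAt (ctr (d + 1) n) n (KInvStep (d := d) n 0) + sgnK (coDressKBmAt (ctr (d + 1) n) n (KInvStep (d := d) n 0)))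
                                          - ffK (coDressKBmAt (ctr (d + 1) n) n (KInvStep (d := d) n 0))) (V ν z))
                              (GcombSh (d := d) n 0 - coDressKBmAt (ctr (d + 1) n) n (KInvStep (d := d) n 0))) (V μ 0))) :=
  lead_eq_blind_add_channel n (spr_mmBlock _ spr_G0bm_ctr) (fun x y α b => mmBlock_inl _ x y α b) (fun x y a β => mmBlock_inl_right _ x y a β)
    hV hW μ ν z

end RecordMM

end Summit.QuantumFields.BalabanUV.Beta.D1BFx.ChartDefectCorrectorChannelRecord

end
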